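import Literature.Analysis.FluidPDE.BoltzmannEquationProofs
import Literature.Analysis.FluidPDE.SphereMeasureSymmetry
import Mathlib.Analysis.SpecialFunctions.JapaneseBracket
import HarnessLib

/-!
# The weak formulation of the Boltzmann collision operator

Topic: Analysis / FluidPDE (kinetic theory). Maxwell's weak (symmetrised) formulation of the
collision operator `Q_B(g, g)` of `Literature.Analysis.FluidPDE.BoltzmannEquation`
(`collisionOpWith`), for a general collision kernel `B(v, v_*, ω)` on a finite-dimensional real
inner product space `E` with the two micro-reversibility symmetries of the tree
(`B(v', v_*', -ω) = B(v, v_*, ω)`, `B(v_*, v, -ω) = B(v, v_*, ω)`, whole-sphere convention, as in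
`IsGradCutoffKernel` and `Literature.MathematicalPhysics.KineticTheory.IsDiPernaLionsKernel`).
Everything here is **proved**; the file declares theorems only.

* `measurePreserving_swap_negDir`, `measurePreserving_collideSwap_prod`: the involutions
  `T₂ : (v, v_*, ω) ↦ (v_*, v, -ω)` and `T₁ : (v, v_*, ω) ↦ (v_*', v', ω)` preserve the measure
  `dv dv_* dω` on `E × E × S^{d-1}` (unit Jacobian of the collision transformation,
  CIP 1994 §3.1 p. 35; fibrewise `measurePreserving_collideSwap`), with the change-of-variables
  formulas `integral_comp_swap_negDir`, `integral_comp_collideSwap_prod` and the invariance of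
  integrability.
* `integral_collisionOpWith_mul_eq` (**the weak formulation**, CIP 1994 §3.1 (3.1.7)–(3.1.9),
  §5.3 (3.10); Villani 2002 Ch. 1 §2.3 (40)): if `B (g'g_*' - g g_*) ψ(v)` is integrable on
  `E × E × S^{d-1}` then
  `∫ Q_B(g,g) ψ dv = ¼ ∫∫∫ B (g'g_*' - g g_*)(ψ + ψ_* - ψ' - ψ_*') dω dv_* dv`;
  `integrable_collisionWeakIntegrand`: the symmetrised integrand is then integrable.
* `integral_collisionOpWith_mul_eq_zero` (collision invariants annihilate `Q`, CIP 1994 §3.1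
  Cor. after (3.1.9)), `integral_collisionOpWith_eq_zero_of_symm` (`ψ ≡ 1`).
* `integral_collisionOpWith_mul_const_add_log_eq` (**H-theorem identity**, CIP 1994 §3.2
  (3.2.4)–(3.2.6)): for `g > 0`, `∫ Q_B(g,g) (a + log g) dv = -D_B(g)` with the entropy production
  `Literature.Analysis.FluidPDE.entropyProduction`; `integrable_entropyProduction_integrand`.
* `integrable_kernel_mul_mul_weight`, `integrable_collisionWeakIntegrand_of_decay`,
  `abs_collisionIntegrand_le_of_decay`, `exists_abs_collisionOpWith_le_of_decay`: the
  integrability of the weak integrands and the pointwise decay `|Q_B(g,g)(v)| ≤ C (1 + ‖v‖)^{-r}`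
  for kernels of polynomial growth `0 ≤ B ≤ C_B (1 + ‖v - v_*‖)^k`, densities of polynomial decay
  `(1 + ‖u‖)^N |g u| ≤ C_g` and weights of polynomial growth (CIP 1994 §5.3, proof of Lemma 5.3.1:
  "if `φ` is of polynomial growth and `g` decreases rapidly"), via `integrable_one_add_norm` and
  conservation of energy (`one_add_norm_mul_le_three_mul_sq`).

These are the tools for the a priori identities (3.4)–(3.7) of CIP 1994 Lemma 5.3.1 for the
DiPerna–Lions approximate solutions
(`Literature.MathematicalPhysics.KineticTheory.approximateSolution_conservation`,
`…approximateSolution_entropy_identity`).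

## Faithfulness / design notes

* No sign or growth condition on `B` enters the weak formulation itself: only measure
  preservation and the two symmetries are used, and a single integrability hypothesis (that of
  `B (g'g_*' - g g_*) ψ(v)`), the other three symmetrised terms being its images under `T₁`, `T₂`,
  `T₁ T₂`. This is exactly the shape of the hard-sphere statements `Hilbert6Wave0`'s
  `integral_collisionOp_mul` / `integral_collisionOp_mul_eq_zero` and of
  `entropyProduction_eq_neg_integral_collisionOp_mul_log` (all for kernels having these
  symmetries), which therefore follow from the results here.
* `MeasurableEquiv`s are packaged existentially (`exists_measurableEquiv_swapNegDir`,
  `exists_measurableEquiv_collideSwap_prod`), as in `BoltzmannEquationProofs`, so that the file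
  declares no definitions.
* The sphere `S^{d-1}` may be empty (`dim E = 0`); no statement needs it to be nonempty.

## References

* C. Cercignani, R. Illner, M. Pulvirenti, *The Mathematical Theory of Dilute Gases*, Springer
  (1994): §3.1 (3.1.7)–(3.1.9) and Cor., p. 35 (unit Jacobian); §3.2 (3.2.4)–(3.2.6); §5.3
  Lemma 5.3.1 and (3.10), pp. 141–142.
* C. Villani, *A review of mathematical topics in collisional kinetic theory*, Handbook of
  Mathematical Fluid Dynamics I (2002), Ch. 1 §2.3 formula (40), §2.4.
-/

open MeasureTheory Metric Real Set Filter Topology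
open scoped InnerProductSpace ENNReal

namespace Literature.Analysis.FluidPDE

noncomputable section

open Literature.MathematicalPhysics.KineticTheory (collide sphereMeasure IsCollisionInvariant)

section Symmetries

variable {E : Type*} [NormedAddCommGroup E] [InnerProductSpace ℝ E]

/-- The collision law does not see the orientation of the impact direction:
`collide (-ω) p = collide ω p`. [folklore] -/
theorem collide_neg_dir (ω : sphere (0 : E) 1) (p : E × E) : collide (-ω) p = collide ω p := by
  simp only [collide, coe_neg_sphere, inner_neg_right, smul_neg, neg_smul, neg_neg]

/-- `collide ω` applied after the swapped collision map returns the swapped pair: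
`collide ω ((collide ω p).swap) = p.swap`. [folklore] -/
theorem collide_collideSwap (ω : sphere (0 : E) 1) (p : E × E) :
    collide ω (collide ω p).swap = p.swap := by
  rw [collide_swap, Literature.MathematicalPhysics.KineticTheory.collide_collide]

variable [FiniteDimensional ℝ E] [MeasurableSpace E] [BorelSpace E]

/-- The exchange-and-reverse map `T₂ : (v, v_*, ω) ↦ (v_*, v, -ω)` preserves `dv dv_* dω`.
[folklore] -/
theorem measurePreserving_swap_negDir :
    MeasurePreserving (fun q : (E × E) × sphere (0 : E) 1 => (q.1.swap, -q.2))
      (((volume : Measure E).prod volume).prod sphereMeasure)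
      (((volume : Measure E).prod volume).prod sphereMeasure) := by
  haveI := isFiniteMeasure_sphereMeasure (E := E)
  have h1 : MeasurePreserving (Prod.swap : E × E → E × E) ((volume : Measure E).prod volume)
      ((volume : Measure E).prod volume) := Measure.measurePreserving_swap
  exact h1.prod measurePreserving_neg_sphere

/-- The swapped collision map `T₁ : (v, v_*, ω) ↦ (v_*', v', ω)` preserves `dv dv_* dω`
(fibrewise the unit-Jacobian change of variables `measurePreserving_collideSwap`). [folklore] -/
theorem measurePreserving_collideSwap_prod :
    MeasurePreserving (fun q : (E × E) × sphere (0 : E) 1 => ((collide q.2 q.1).swap, q.2))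
      (((volume : Measure E).prod volume).prod sphereMeasure)
      (((volume : Measure E).prod volume).prod sphereMeasure) := by
  haveI := isFiniteMeasure_sphereMeasure (E := E)
  -- skew product over the sphere factor, conjugated by the swap of the two factors
  have hskew : MeasurePreserving
      (fun q : sphere (0 : E) 1 × (E × E) => (q.1, (collide q.1 q.2).swap))
      ((sphereMeasure : Measure (sphere (0 : E) 1)).prod ((volume : Measure E).prod volume))
      ((sphereMeasure : Measure (sphere (0 : E) 1)).prod ((volume : Measure E).prod volume)) := by
    refine (MeasurePreserving.id (sphereMeasure : Measure (sphere (0 : E) 1))).skew_product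
      (g := fun (ω : sphere (0 : E) 1) (p : E × E) => (collide ω p).swap) ?_
      (ae_of_all _ fun ω => (measurePreserving_collideSwap ω).map_eq)
    exact (continuous_collide_uncurry.comp continuous_swap).snd.prodMk
      ((continuous_collide_uncurry.comp continuous_swap).fst) |>.measurable
  have hsw1 : MeasurePreserving (Prod.swap : (E × E) × sphere (0 : E) 1 → sphere (0 : E) 1 × (E × E))
      (((volume : Measure E).prod volume).prod sphereMeasure)
      ((sphereMeasure : Measure (sphere (0 : E) 1)).prod ((volume : Measure E).prod volume)) :=
    Measure.measurePreserving_swap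
  have hsw2 : MeasurePreserving (Prod.swap : sphere (0 : E) 1 × (E × E) → (E × E) × sphere (0 : E) 1)
      ((sphereMeasure : Measure (sphere (0 : E) 1)).prod ((volume : Measure E).prod volume))
      (((volume : Measure E).prod volume).prod sphereMeasure) :=
    Measure.measurePreserving_swap
  exact (hsw2.comp hskew).comp hsw1

omit [InnerProductSpace ℝ E] [FiniteDimensional ℝ E] [MeasurableSpace E] [BorelSpace E] in
/-- `T₂ ∘ T₂ = id`. [folklore] -/
theorem swap_negDir_involutive (q : (E × E) × sphere (0 : E) 1) :
    ((fun q : (E × E) × sphere (0 : E) 1 => (q.1.swap, -q.2))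
      ((fun q : (E × E) × sphere (0 : E) 1 => (q.1.swap, -q.2)) q)) = q := by
  simp

omit [FiniteDimensional ℝ E] [MeasurableSpace E] [BorelSpace E] in
/-- `T₁ ∘ T₁ = id`. [folklore] -/
theorem collideSwap_prod_involutive (q : (E × E) × sphere (0 : E) 1) :
    ((fun q : (E × E) × sphere (0 : E) 1 => ((collide q.2 q.1).swap, q.2))
      ((fun q : (E × E) × sphere (0 : E) 1 => ((collide q.2 q.1).swap, q.2)) q)) = q := by
  obtain ⟨p, ω⟩ := q
  simp only [collideSwap_collideSwap]

omit [InnerProductSpace ℝ E] [FiniteDimensional ℝ E] in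
/-- The exchange-and-reverse map `T₂` is a measurable involution of `E × E × S^{d-1}` (packaged
existentially as a `MeasurableEquiv`, so that this file only declares theorems). [folklore] -/
theorem exists_measurableEquiv_swapNegDir :
    ∃ e : (E × E) × sphere (0 : E) 1 ≃ᵐ (E × E) × sphere (0 : E) 1, ∀ q, e q = (q.1.swap, -q.2) :=
  ⟨{ toFun := fun q => (q.1.swap, -q.2)
     invFun := fun q => (q.1.swap, -q.2)
     left_inv := fun q => by simp
     right_inv := fun q => by simp
     measurable_toFun :=
       (measurable_swap.comp measurable_fst).prodMk (measurable_neg.comp measurable_snd)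
     measurable_invFun :=
       (measurable_swap.comp measurable_fst).prodMk (measurable_neg.comp measurable_snd) },
    fun _ => rfl⟩

/-- The swapped collision map `T₁` is a measurable involution of `E × E × S^{d-1}` (packaged
existentially). [folklore] -/
theorem exists_measurableEquiv_collideSwap_prod :
    ∃ e : (E × E) × sphere (0 : E) 1 ≃ᵐ (E × E) × sphere (0 : E) 1,
      ∀ q, e q = ((collide q.2 q.1).swap, q.2) :=
  ⟨{ toFun := fun q => ((collide q.2 q.1).swap, q.2)
     invFun := fun q => ((collide q.2 q.1).swap, q.2)
     left_inv := fun q => collideSwap_prod_involutive q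
     right_inv := fun q => collideSwap_prod_involutive q
     measurable_toFun :=
       ((continuous_collide_uncurry.snd.prodMk continuous_collide_uncurry.fst).prodMk
         continuous_snd).measurable
     measurable_invFun :=
       ((continuous_collide_uncurry.snd.prodMk continuous_collide_uncurry.fst).prodMk
         continuous_snd).measurable },
    fun _ => rfl⟩

/-- **Change of variables `(v, v_*, ω) ↦ (v_*, v, -ω)`** in integrals over `E × E × S^{d-1}`.
[folklore] -/
theorem integral_comp_swap_negDir {F : Type*} [NormedAddCommGroup F] [NormedSpace ℝ F]
    (K : (E × E) × sphere (0 : E) 1 → F) :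
    ∫ q, K (q.1.swap, -q.2) ∂(((volume : Measure E).prod volume).prod sphereMeasure) =
      ∫ q, K q ∂(((volume : Measure E).prod volume).prod sphereMeasure) := by
  obtain ⟨e, he⟩ := exists_measurableEquiv_swapNegDir (E := E)
  have hfun : (fun q : (E × E) × sphere (0 : E) 1 => (q.1.swap, -q.2)) = e :=
    funext fun q => (he q).symm
  have hpres : MeasurePreserving e (((volume : Measure E).prod volume).prod sphereMeasure)
      (((volume : Measure E).prod volume).prod sphereMeasure) := by
    rw [← hfun]; exact measurePreserving_swap_negDir
  have h := hpres.integral_comp' K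
  simpa only [he] using h

/-- **Change of variables `(v, v_*, ω) ↦ (v_*', v', ω)`** in integrals over `E × E × S^{d-1}`
(unit Jacobian of the collision transformation, CIP 1994 §3.1 p. 35). [cite: CIPDiluteGases1994, §3.1 p. 35] -/
theorem integral_comp_collideSwap_prod {F : Type*} [NormedAddCommGroup F] [NormedSpace ℝ F]
    (K : (E × E) × sphere (0 : E) 1 → F) :
    ∫ q, K ((collide q.2 q.1).swap, q.2) ∂(((volume : Measure E).prod volume).prod sphereMeasure) =
      ∫ q, K q ∂(((volume : Measure E).prod volume).prod sphereMeasure) := by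
  obtain ⟨e, he⟩ := exists_measurableEquiv_collideSwap_prod (E := E)
  have hfun : (fun q : (E × E) × sphere (0 : E) 1 => ((collide q.2 q.1).swap, q.2)) = e :=
    funext fun q => (he q).symm
  have hpres : MeasurePreserving e (((volume : Measure E).prod volume).prod sphereMeasure)
      (((volume : Measure E).prod volume).prod sphereMeasure) := by
    rw [← hfun]; exact measurePreserving_collideSwap_prod
  have h := hpres.integral_comp' K
  simpa only [he] using h

/-- Integrability is invariant under `T₂`. [folklore] -/
theorem integrable_comp_swap_negDir_iff {F : Type*} [NormedAddCommGroup F]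
    (K : (E × E) × sphere (0 : E) 1 → F) :
    Integrable (fun q => K (q.1.swap, -q.2)) (((volume : Measure E).prod volume).prod sphereMeasure) ↔
      Integrable K (((volume : Measure E).prod volume).prod sphereMeasure) :=
by
  obtain ⟨e, he⟩ := exists_measurableEquiv_swapNegDir (E := E)
  have hfun : (fun q : (E × E) × sphere (0 : E) 1 => (q.1.swap, -q.2)) = e :=
    funext fun q => (he q).symm
  have h := (measurePreserving_swap_negDir (E := E)).integrable_comp_emb (g := K)
    (by rw [hfun]; exact e.measurableEmbedding)
  exact h

/-- Integrability is invariant under `T₁`. [folklore] -/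
theorem integrable_comp_collideSwap_prod_iff {F : Type*} [NormedAddCommGroup F]
    (K : (E × E) × sphere (0 : E) 1 → F) :
    Integrable (fun q => K ((collide q.2 q.1).swap, q.2))
        (((volume : Measure E).prod volume).prod sphereMeasure) ↔
      Integrable K (((volume : Measure E).prod volume).prod sphereMeasure) :=
by
  obtain ⟨e, he⟩ := exists_measurableEquiv_collideSwap_prod (E := E)
  have hfun : (fun q : (E × E) × sphere (0 : E) 1 => ((collide q.2 q.1).swap, q.2)) = e :=
    funext fun q => (he q).symm
  have h := (measurePreserving_collideSwap_prod (E := E)).integrable_comp_emb (g := K)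
    (by rw [hfun]; exact e.measurableEmbedding)
  exact h

end Symmetries

/-! ## The weak formulation -/

section WeakForm

variable {E : Type*} [NormedAddCommGroup E] [InnerProductSpace ℝ E] [FiniteDimensional ℝ E]
  [MeasurableSpace E] [BorelSpace E] {B : E × E → sphere (0 : E) 1 → ℝ}

omit [FiniteDimensional ℝ E] [MeasurableSpace E] [BorelSpace E] in
/-- A kernel with the two micro-reversibility symmetries `B(v', v_*', -ω) = B(v, v_*, ω)` and
`B(v_*, v, -ω) = B(v, v_*, ω)` is invariant under the swapped collision map:
`B(v_*', v', ω) = B(v, v_*, ω)`. [folklore] -/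
theorem kernel_collideSwap (hBc : ∀ p ω, B (collide ω p) (-ω) = B p ω)
    (hBs : ∀ p ω, B p.swap (-ω) = B p ω) (p : E × E) (ω : sphere (0 : E) 1) :
    B (collide ω p).swap ω = B p ω := by
  have h1 := hBs (collide ω p).swap ω
  rw [Prod.swap_swap, hBc] at h1
  exact h1.symm

/-- **Weak formulation of the collision operator** (Maxwell's symmetrisation; CIP 1994 §3.1
(3.1.7)–(3.1.9) and §5.3 (3.10); Villani 2002 Ch. 1 §2.3 (40)). Let `B ≥ 0`… no sign is needed:
let `B` be any kernel with the micro-reversibility symmetries `B(v', v_*', -ω) = B(v, v_*, ω)`,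
`B(v_*, v, -ω) = B(v, v_*, ω)` (whole-sphere convention), and let `g, ψ` be such that the
integrand `B (g' g_*' - g g_*) ψ(v)` is integrable on `E × E × S^{d-1}`. Then
`∫ Q_B(g, g)(v) ψ(v) dv = ¼ ∫∫∫ B (g' g_*' - g g_*) (ψ + ψ_* - ψ' - ψ_*') dω dv_* dv`.
Proof: Fubini, then the measure-preserving involutions `(v, v_*, ω) ↦ (v_*, v, -ω)` and
`(v, v_*, ω) ↦ (v_*', v', ω)` of `E × E × S^{d-1}`, under which the integrand is multiplied by
`ψ_*/ψ`, resp. `-ψ_*'/ψ`. [cite: CIPDiluteGases1994, §3.1 (3.1.7)–(3.1.9)] -/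
theorem integral_collisionOpWith_mul_eq (hBc : ∀ p ω, B (collide ω p) (-ω) = B p ω)
    (hBs : ∀ p ω, B p.swap (-ω) = B p ω) (g ψ : E → ℝ)
    (hint : Integrable (fun q : (E × E) × sphere (0 : E) 1 =>
        B q.1 q.2 * (g (collide q.2 q.1).1 * g (collide q.2 q.1).2 - g q.1.1 * g q.1.2) * ψ q.1.1)
      (((volume : Measure E).prod volume).prod sphereMeasure)) :
    ∫ v, collisionOpWith B g g v * ψ v =
      4⁻¹ * ∫ q, B q.1 q.2 * (g (collide q.2 q.1).1 * g (collide q.2 q.1).2 - g q.1.1 * g q.1.2) *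
        (ψ q.1.1 + ψ q.1.2 - ψ (collide q.2 q.1).1 - ψ (collide q.2 q.1).2)
        ∂(((volume : Measure E).prod volume).prod sphereMeasure) := by
  haveI := isFiniteMeasure_sphereMeasure (E := E)
  set μ : Measure ((E × E) × sphere (0 : E) 1) :=
    ((volume : Measure E).prod volume).prod sphereMeasure with hμ
  -- the antisymmetric density `D = B (g'g_*' - g g_*)` and the four weighted integrands
  set D : (E × E) × sphere (0 : E) 1 → ℝ := fun q =>
    B q.1 q.2 * (g (collide q.2 q.1).1 * g (collide q.2 q.1).2 - g q.1.1 * g q.1.2) with hD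
  set K₁ : (E × E) × sphere (0 : E) 1 → ℝ := fun q => D q * ψ q.1.1 with hK₁
  set K₂ : (E × E) × sphere (0 : E) 1 → ℝ := fun q => D q * ψ q.1.2 with hK₂
  set K₃ : (E × E) × sphere (0 : E) 1 → ℝ := fun q => D q * ψ (collide q.2 q.1).1 with hK₃
  set K₄ : (E × E) × sphere (0 : E) 1 → ℝ := fun q => D q * ψ (collide q.2 q.1).2 with hK₄
  have hK₁i : Integrable K₁ μ := hint
  -- behaviour of `D` under the two involutions
  have hD₂ : ∀ q : (E × E) × sphere (0 : E) 1, D (q.1.swap, -q.2) = D q := by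
    intro q
    simp only [hD, collide_neg_dir, collide_swap, Prod.fst_swap, Prod.snd_swap, hBs]
    ring
  have hD₁ : ∀ q : (E × E) × sphere (0 : E) 1, D ((collide q.2 q.1).swap, q.2) = -D q := by
    intro q
    simp only [hD, collide_collideSwap, Prod.fst_swap, Prod.snd_swap, kernel_collideSwap hBc hBs]
    ring
  -- `K₁ ∘ T₂ = K₂`, `K₁ ∘ T₁ = -K₄`, `K₄ ∘ T₂ = K₃`
  have hK₁₂ : ∀ q : (E × E) × sphere (0 : E) 1, K₁ (q.1.swap, -q.2) = K₂ q := by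
    intro q; simp only [hK₁, hK₂, hD₂, Prod.fst_swap]
  have hK₁₄ : ∀ q : (E × E) × sphere (0 : E) 1, K₁ ((collide q.2 q.1).swap, q.2) = -K₄ q := by
    intro q; simp only [hK₁, hK₄, hD₁, Prod.fst_swap, neg_mul]
  have hK₄₃ : ∀ q : (E × E) × sphere (0 : E) 1, K₄ (q.1.swap, -q.2) = K₃ q := by
    intro q; simp only [hK₄, hK₃, hD₂, collide_neg_dir, collide_swap, Prod.snd_swap]
  -- integrability of `K₂, K₃, K₄`
  have hK₂i : Integrable K₂ μ := by
    have := (integrable_comp_swap_negDir_iff K₁).2 hK₁i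
    exact this.congr (Eventually.of_forall hK₁₂)
  have hK₄i : Integrable K₄ μ := by
    have := ((integrable_comp_collideSwap_prod_iff K₁).2 hK₁i).neg
    exact this.congr (Eventually.of_forall fun q => by simp only [Pi.neg_apply, hK₁₄, neg_neg])
  have hK₃i : Integrable K₃ μ := by
    have := (integrable_comp_swap_negDir_iff K₄).2 hK₄i
    exact this.congr (Eventually.of_forall hK₄₃)
  -- the integrals of `K₂, K₃, K₄` in terms of `∫ K₁`
  have hI₂ : ∫ q, K₂ q ∂μ = ∫ q, K₁ q ∂μ := by
    rw [← integral_comp_swap_negDir K₁]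
    exact integral_congr_ae (Eventually.of_forall fun q => (hK₁₂ q).symm)
  have hI₄ : ∫ q, K₄ q ∂μ = -∫ q, K₁ q ∂μ := by
    rw [← integral_comp_collideSwap_prod K₁, ← integral_neg]
    exact integral_congr_ae (Eventually.of_forall fun q => by simp only [hK₁₄, neg_neg])
  have hI₃ : ∫ q, K₃ q ∂μ = ∫ q, K₄ q ∂μ := by
    rw [← integral_comp_swap_negDir K₄]
    exact integral_congr_ae (Eventually.of_forall fun q => (hK₄₃ q).symm)
  -- Step 1: `∫ Q ψ = ∫ K₁`
  have hLHS : ∫ v, collisionOpWith B g g v * ψ v = ∫ q, K₁ q ∂μ := by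
    have h1 : (fun v => collisionOpWith B g g v * ψ v) =
        fun v => ∫ w, ∫ ω, K₁ ((v, w), ω) ∂sphereMeasure := by
      funext v
      simp only [collisionOpWith, hK₁, hD, ← integral_mul_const]
    have h2 : ∫ v, ∫ w, ∫ ω, K₁ ((v, w), ω) ∂sphereMeasure =
        ∫ p, ∫ ω, K₁ (p, ω) ∂sphereMeasure ∂((volume : Measure E).prod volume) :=
      (integral_prod (fun p : E × E => ∫ ω, K₁ (p, ω) ∂sphereMeasure)
        hK₁i.integral_prod_left).symm
    rw [h1, h2, ← integral_prod _ hK₁i]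
  -- Step 2: symmetrise
  have hsum : ∫ q, (K₁ q + K₂ q - K₃ q - K₄ q) ∂μ = 4 * ∫ q, K₁ q ∂μ := by
    have e1 : ∫ q, (K₁ q + K₂ q - K₃ q - K₄ q) ∂μ =
        (∫ q, (K₁ q + K₂ q - K₃ q) ∂μ) - ∫ q, K₄ q ∂μ :=
      integral_sub ((hK₁i.add hK₂i).sub hK₃i) hK₄i
    have e2 : ∫ q, (K₁ q + K₂ q - K₃ q) ∂μ = (∫ q, (K₁ q + K₂ q) ∂μ) - ∫ q, K₃ q ∂μ :=
      integral_sub (hK₁i.add hK₂i) hK₃i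
    have e3 : ∫ q, (K₁ q + K₂ q) ∂μ = (∫ q, K₁ q ∂μ) + ∫ q, K₂ q ∂μ := integral_add hK₁i hK₂i
    rw [e1, e2, e3, hI₂, hI₃, hI₄]
    ring
  rw [hLHS]
  have hpt : (fun q : (E × E) × sphere (0 : E) 1 => B q.1 q.2 *
      (g (collide q.2 q.1).1 * g (collide q.2 q.1).2 - g q.1.1 * g q.1.2) *
        (ψ q.1.1 + ψ q.1.2 - ψ (collide q.2 q.1).1 - ψ (collide q.2 q.1).2)) =
      fun q => K₁ q + K₂ q - K₃ q - K₄ q := by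
    funext q; simp only [hK₁, hK₂, hK₃, hK₄, hD]; ring
  rw [hpt, hsum]
  ring

/-- The symmetrised weak integrand `B (g'g_*' - g g_*) (ψ + ψ_* - ψ' - ψ_*')` is integrable as
soon as `B (g'g_*' - g g_*) ψ` is (the other three terms are its images under measure-preserving
involutions). [folklore] -/
theorem integrable_collisionWeakIntegrand (hBc : ∀ p ω, B (collide ω p) (-ω) = B p ω)
    (hBs : ∀ p ω, B p.swap (-ω) = B p ω) (g ψ : E → ℝ)
    (hint : Integrable (fun q : (E × E) × sphere (0 : E) 1 =>
        B q.1 q.2 * (g (collide q.2 q.1).1 * g (collide q.2 q.1).2 - g q.1.1 * g q.1.2) * ψ q.1.1)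
      (((volume : Measure E).prod volume).prod sphereMeasure)) :
    Integrable (fun q : (E × E) × sphere (0 : E) 1 =>
        B q.1 q.2 * (g (collide q.2 q.1).1 * g (collide q.2 q.1).2 - g q.1.1 * g q.1.2) *
          (ψ q.1.1 + ψ q.1.2 - ψ (collide q.2 q.1).1 - ψ (collide q.2 q.1).2))
      (((volume : Measure E).prod volume).prod sphereMeasure) := by
  haveI := isFiniteMeasure_sphereMeasure (E := E)
  set μ : Measure ((E × E) × sphere (0 : E) 1) :=
    ((volume : Measure E).prod volume).prod sphereMeasure with hμ
  set D : (E × E) × sphere (0 : E) 1 → ℝ := fun q =>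
    B q.1 q.2 * (g (collide q.2 q.1).1 * g (collide q.2 q.1).2 - g q.1.1 * g q.1.2) with hD
  set K₁ : (E × E) × sphere (0 : E) 1 → ℝ := fun q => D q * ψ q.1.1 with hK₁
  set K₂ : (E × E) × sphere (0 : E) 1 → ℝ := fun q => D q * ψ q.1.2 with hK₂
  set K₃ : (E × E) × sphere (0 : E) 1 → ℝ := fun q => D q * ψ (collide q.2 q.1).1 with hK₃
  set K₄ : (E × E) × sphere (0 : E) 1 → ℝ := fun q => D q * ψ (collide q.2 q.1).2 with hK₄
  have hK₁i : Integrable K₁ μ := hint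
  have hD₂ : ∀ q : (E × E) × sphere (0 : E) 1, D (q.1.swap, -q.2) = D q := by
    intro q
    simp only [hD, collide_neg_dir, collide_swap, Prod.fst_swap, Prod.snd_swap, hBs]
    ring
  have hD₁ : ∀ q : (E × E) × sphere (0 : E) 1, D ((collide q.2 q.1).swap, q.2) = -D q := by
    intro q
    simp only [hD, collide_collideSwap, Prod.fst_swap, Prod.snd_swap, kernel_collideSwap hBc hBs]
    ring
  have hK₂i : Integrable K₂ μ := by
    have := (integrable_comp_swap_negDir_iff K₁).2 hK₁i
    exact this.congr (Eventually.of_forall fun q => by simp only [hK₁, hK₂, hD₂, Prod.fst_swap])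
  have hK₄i : Integrable K₄ μ := by
    have := ((integrable_comp_collideSwap_prod_iff K₁).2 hK₁i).neg
    exact this.congr (Eventually.of_forall fun q => by
      simp only [Pi.neg_apply, hK₁, hK₄, hD₁, Prod.fst_swap, neg_mul, neg_neg])
  have hK₃i : Integrable K₃ μ := by
    have := (integrable_comp_swap_negDir_iff K₄).2 hK₄i
    exact this.congr (Eventually.of_forall fun q => by
      simp only [hK₄, hK₃, hD₂, collide_neg_dir, collide_swap, Prod.snd_swap])
  have := ((hK₁i.add hK₂i).sub hK₃i).sub hK₄i
  refine this.congr (Eventually.of_forall fun q => ?_)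
  simp only [Pi.add_apply, Pi.sub_apply, hK₁, hK₂, hK₃, hK₄, hD]
  ring

/-- **Collision invariants annihilate the collision operator** (formal conservation of mass,
momentum and energy; CIP 1994 §3.1 Cor. after (3.1.9), §5.3 (3.10): "the right-hand side of
(3.10) is zero if `φ` is a collision invariant"): for a kernel with the micro-reversibility
symmetries, a collision invariant `ψ` (`Hilbert6.IsCollisionInvariant`: `ψ' + ψ_*' = ψ + ψ_*`) and
an integrable weak integrand, `∫ Q_B(g, g) ψ dv = 0`. [cite: CIPDiluteGases1994, §3.1 Cor. after (3.1.9)] -/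
theorem integral_collisionOpWith_mul_eq_zero (hBc : ∀ p ω, B (collide ω p) (-ω) = B p ω)
    (hBs : ∀ p ω, B p.swap (-ω) = B p ω) {g ψ : E → ℝ} (hψ : IsCollisionInvariant ψ)
    (hint : Integrable (fun q : (E × E) × sphere (0 : E) 1 =>
        B q.1 q.2 * (g (collide q.2 q.1).1 * g (collide q.2 q.1).2 - g q.1.1 * g q.1.2) * ψ q.1.1)
      (((volume : Measure E).prod volume).prod sphereMeasure)) :
    ∫ v, collisionOpWith B g g v * ψ v = 0 := by
  rw [integral_collisionOpWith_mul_eq hBc hBs g ψ hint]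
  have h0 : ∀ q : (E × E) × sphere (0 : E) 1,
      ψ q.1.1 + ψ q.1.2 - ψ (collide q.2 q.1).1 - ψ (collide q.2 q.1).2 = 0 := fun q => by
    have := hψ q.2 q.1
    linarith
  simp [h0]

/-- **`∫ Q_B(g, g) dv = 0`** for a micro-reversible kernel and an integrable collision integrand
`B (g'g_*' - g g_*)` (the collision invariant `ψ ≡ 1`; CIP 1994 §3.1 (1.12)). [cite: CIPDiluteGases1994, §3.1 (1.12)] -/
theorem integral_collisionOpWith_eq_zero_of_symm (hBc : ∀ p ω, B (collide ω p) (-ω) = B p ω)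
    (hBs : ∀ p ω, B p.swap (-ω) = B p ω) {g : E → ℝ}
    (hint : Integrable (fun q : (E × E) × sphere (0 : E) 1 =>
        B q.1 q.2 * (g (collide q.2 q.1).1 * g (collide q.2 q.1).2 - g q.1.1 * g q.1.2))
      (((volume : Measure E).prod volume).prod sphereMeasure)) :
    ∫ v, collisionOpWith B g g v = 0 := by
  have h := integral_collisionOpWith_mul_eq_zero hBc hBs (g := g)
    (Literature.MathematicalPhysics.KineticTheory.isCollisionInvariant_quadratic 1 0 (0 : E))
    (by simpa using hint)
  simpa using h

/-- **The H-theorem identity** (Boltzmann; CIP 1994 §3.2 (3.2.4)–(3.2.6), §5.3 proof of (3.7):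
"let `φ = ln f` in (3.10)"; Villani 2002 Ch. 1 §2.4): for a micro-reversible kernel, `g > 0`, a
constant `a` and an integrable weak integrand `B (g'g_*' - g g_*) (a + log g(v))`,
`∫ Q_B(g, g)(v) (a + log g(v)) dv = -D_B(g)` where
`D_B(g) = ¼ ∫∫∫ B (g'g_*' - g g_*) log (g'g_*'/(g g_*)) ≥ 0` is the entropy production
`Literature.Analysis.FluidPDE.entropyProduction`. (`a = 0`: `∫ Q log g = -D`; `a = 1`:
`∫ Q (1 + log g) = -D`, the form in which it enters `d/dt ∫ g log g`.) [cite: CIPDiluteGases1994, §3.2 (3.2.4)–(3.2.6)] -/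
theorem integral_collisionOpWith_mul_const_add_log_eq (hBc : ∀ p ω, B (collide ω p) (-ω) = B p ω)
    (hBs : ∀ p ω, B p.swap (-ω) = B p ω) {g : E → ℝ} (hpos : ∀ v, 0 < g v) (a : ℝ)
    (hint : Integrable (fun q : (E × E) × sphere (0 : E) 1 =>
        B q.1 q.2 * (g (collide q.2 q.1).1 * g (collide q.2 q.1).2 - g q.1.1 * g q.1.2) *
          (a + log (g q.1.1)))
      (((volume : Measure E).prod volume).prod sphereMeasure)) :
    ∫ v, collisionOpWith B g g v * (a + log (g v)) = -entropyProduction B g := by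
  rw [integral_collisionOpWith_mul_eq hBc hBs g (fun v => a + log (g v)) hint, entropyProduction,
    ← mul_neg, ← integral_neg]
  congr 1
  refine integral_congr_ae (Eventually.of_forall fun q => ?_)
  have h1 := hpos q.1.1
  have h2 := hpos q.1.2
  have h3 := hpos (collide q.2 q.1).1
  have h4 := hpos (collide q.2 q.1).2
  simp only
  rw [Real.log_div (mul_pos h3 h4).ne' (mul_pos h1 h2).ne', Real.log_mul h3.ne' h4.ne',
    Real.log_mul h1.ne' h2.ne']
  ring

/-- The entropy-production integrand `B (g'g_*' - g g_*) log (g'g_*'/(g g_*))` of a positive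
density is integrable as soon as the weak integrand `B (g'g_*' - g g_*) log g(v)` is. [folklore] -/
theorem integrable_entropyProduction_integrand (hBc : ∀ p ω, B (collide ω p) (-ω) = B p ω)
    (hBs : ∀ p ω, B p.swap (-ω) = B p ω) {g : E → ℝ} (hpos : ∀ v, 0 < g v)
    (hint : Integrable (fun q : (E × E) × sphere (0 : E) 1 =>
        B q.1 q.2 * (g (collide q.2 q.1).1 * g (collide q.2 q.1).2 - g q.1.1 * g q.1.2) *
          log (g q.1.1))
      (((volume : Measure E).prod volume).prod sphereMeasure)) :
    Integrable (fun q : (E × E) × sphere (0 : E) 1 => B q.1 q.2 *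
        ((g (collide q.2 q.1).1 * g (collide q.2 q.1).2 - g q.1.1 * g q.1.2) *
          log (g (collide q.2 q.1).1 * g (collide q.2 q.1).2 / (g q.1.1 * g q.1.2))))
      (((volume : Measure E).prod volume).prod sphereMeasure) := by
  have h := (integrable_collisionWeakIntegrand hBc hBs g (fun v => log (g v)) hint).neg
  refine h.congr (Eventually.of_forall fun q => ?_)
  have h1 := hpos q.1.1
  have h2 := hpos q.1.2
  have h3 := hpos (collide q.2 q.1).1
  have h4 := hpos (collide q.2 q.1).2
  simp only [Pi.neg_apply]
  rw [Real.log_div (mul_pos h3 h4).ne' (mul_pos h1 h2).ne', Real.log_mul h3.ne' h4.ne',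
    Real.log_mul h1.ne' h2.ne']
  ring

end WeakForm

/-! ## Integrability of the weak integrands for rapidly decaying densities -/

section Decay

variable {E : Type*} [NormedAddCommGroup E] [InnerProductSpace ℝ E]

/-- Post-collisional speeds are controlled by the pre-collisional ones:
`‖v_*'‖ ≤ ‖v‖ + ‖v_*‖` (conservation of energy). [folklore] -/
theorem norm_collide_snd_le (ω : sphere (0 : E) 1) (p : E × E) :
    ‖(collide ω p).2‖ ≤ ‖p.1‖ + ‖p.2‖ := by
  have h := Literature.MathematicalPhysics.KineticTheory.norm_sq_collide_fst_add_norm_sq_collide_snd ω p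
  have h1 : ‖(collide ω p).2‖ ^ 2 ≤ (‖p.1‖ + ‖p.2‖) ^ 2 := by
    nlinarith [sq_nonneg ‖(collide ω p).1‖, norm_nonneg p.1, norm_nonneg p.2]
  exact pow_le_pow_iff_left₀ (norm_nonneg _) (by positivity) two_ne_zero |>.1 h1

/-- `‖v'‖ ≤ ‖v‖ + ‖v_*‖`. [folklore] -/
theorem norm_collide_fst_le (ω : sphere (0 : E) 1) (p : E × E) :
    ‖(collide ω p).1‖ ≤ ‖p.1‖ + ‖p.2‖ := by
  have h := Literature.MathematicalPhysics.KineticTheory.norm_sq_collide_fst_add_norm_sq_collide_snd ω p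
  have h1 : ‖(collide ω p).1‖ ^ 2 ≤ (‖p.1‖ + ‖p.2‖) ^ 2 := by
    nlinarith [sq_nonneg ‖(collide ω p).2‖, norm_nonneg p.1, norm_nonneg p.2]
  exact pow_le_pow_iff_left₀ (norm_nonneg _) (by positivity) two_ne_zero |>.1 h1

omit [InnerProductSpace ℝ E] in
/-- From polynomial decay `(1 + ‖u‖)^N |g u| ≤ C` to the weighted bound
`(1 + ‖u‖)^j |g u| ≤ C (1 + ‖u‖)^{-(N - j)}` for `j ≤ N`. [folklore] -/
theorem pow_mul_abs_le_rpow_neg_of_decay {g : E → ℝ} {C : ℝ} {N j : ℕ} (hjN : j ≤ N)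
    (hg : ∀ u, (1 + ‖u‖) ^ N * |g u| ≤ C) (u : E) :
    (1 + ‖u‖) ^ j * |g u| ≤ C * (1 + ‖u‖) ^ (-((N - j : ℕ) : ℝ)) := by
  have h1 : (0 : ℝ) < 1 + ‖u‖ := by positivity
  rw [Real.rpow_neg h1.le, Real.rpow_natCast, ← div_eq_mul_inv, le_div_iff₀ (pow_pos h1 _),
    mul_assoc, mul_comm (|g u|), ← mul_assoc, ← pow_add, Nat.add_sub_cancel' hjN]
  exact hg u

variable [FiniteDimensional ℝ E] [MeasurableSpace E] [BorelSpace E]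
  {B : E × E → sphere (0 : E) 1 → ℝ}

/-- **Domination of the loss-type integrands.** For a measurable kernel of polynomial growth
`0 ≤ B ≤ C_B (1 + ‖v - v_*‖)^k`, a measurable density with `(1 + ‖u‖)^N |g u| ≤ C_g`, and a
measurable weight `|W(v, v_*, ω)| ≤ C_W (1 + ‖v‖)^m (1 + ‖v_*‖)^m`, the integrand
`B g(v) g(v_*) W` is integrable on `E × E × S^{d-1}` as soon as `N > dim E + k + m`
(it is dominated by `C ρ(v) ρ(v_*)` with `ρ(u) = (1 + ‖u‖)^{-(N-k-m)} ∈ L¹`,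
`integrable_one_add_norm`). [folklore] -/
theorem integrable_kernel_mul_mul_weight (hBm : Measurable (Function.uncurry B))
    (hB0 : ∀ p ω, 0 ≤ B p ω) {C_B : ℝ} {k : ℕ} (hBle : ∀ p ω, B p ω ≤ C_B * (1 + ‖p.1 - p.2‖) ^ k)
    {g : E → ℝ} (hgm : Measurable g) {C_g : ℝ} {N : ℕ} (hg : ∀ u, (1 + ‖u‖) ^ N * |g u| ≤ C_g)
    {W : (E × E) × sphere (0 : E) 1 → ℝ} (hWm : Measurable W) {C_W : ℝ} {m : ℕ}
    (hW : ∀ q, |W q| ≤ C_W * ((1 + ‖q.1.1‖) ^ m * (1 + ‖q.1.2‖) ^ m))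
    (hN : Module.finrank ℝ E + k + m < N) :
    Integrable (fun q : (E × E) × sphere (0 : E) 1 => B q.1 q.2 * (g q.1.1 * g q.1.2) * W q)
      (((volume : Measure E).prod volume).prod sphereMeasure) := by
  haveI := isFiniteMeasure_sphereMeasure (E := E)
  have hkm : k + m ≤ N := by omega
  set r : ℝ := ((N - (k + m) : ℕ) : ℝ) with hr
  have hrE : (Module.finrank ℝ E : ℝ) < r := by
    rw [hr]; exact_mod_cast (by omega : Module.finrank ℝ E < N - (k + m))
  set ρ : E → ℝ := fun u => (1 + ‖u‖) ^ (-r) with hρ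
  have hρi : Integrable ρ (volume : Measure E) := integrable_one_add_norm hrE
  have hρ0 : ∀ u, 0 ≤ ρ u := fun u => Real.rpow_nonneg (by positivity) _
  -- constants are nonnegative where it matters
  have hCg : 0 ≤ C_g := le_trans (by positivity) (hg 0)
  -- the weighted decay of `g`
  have hgw : ∀ u, (1 + ‖u‖) ^ (k + m) * |g u| ≤ C_g * ρ u := fun u =>
    pow_mul_abs_le_rpow_neg_of_decay hkm hg u
  -- the dominating function
  have hdom : Integrable (fun q : (E × E) × sphere (0 : E) 1 =>
      C_B * |C_W| * C_g * C_g * (ρ q.1.1 * ρ q.1.2))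
      (((volume : Measure E).prod volume).prod sphereMeasure) :=
    ((hρi.mul_prod hρi).comp_fst sphereMeasure).const_mul _
  refine hdom.mono' ?_ (Eventually.of_forall fun q => ?_)
  · exact ((hBm.mul ((hgm.comp measurable_fst.fst).mul (hgm.comp measurable_fst.snd))).mul
      hWm).aestronglyMeasurable
  obtain ⟨⟨v, w⟩, ω⟩ := q
  rw [Real.norm_eq_abs, abs_mul, abs_mul, abs_of_nonneg (hB0 _ _), abs_mul]
  dsimp only
  have hCB : 0 ≤ C_B := by
    have h1 := (hB0 (v, w) ω).trans (hBle (v, w) ω)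
    exact nonneg_of_mul_nonneg_left h1 (by positivity)
  -- `B ≤ C_B (1+|v|)^k (1+|w|)^k`
  have hB1 : B (v, w) ω ≤ C_B * ((1 + ‖v‖) ^ k * (1 + ‖w‖) ^ k) := by
    refine (hBle (v, w) ω).trans ?_
    rw [← mul_pow]
    exact mul_le_mul_of_nonneg_left (pow_le_pow_left₀ (by positivity) (one_add_norm_sub_le v w) k) hCB
  have hWq := hW ((v, w), ω)
  dsimp only at hWq
  have hv1 : (1 : ℝ) ≤ 1 + ‖v‖ := by linarith [norm_nonneg v]
  have hw1 : (1 : ℝ) ≤ 1 + ‖w‖ := by linarith [norm_nonneg w]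
  -- compare with the product `[(1+|v|)^(k+m) |g v|] [(1+|w|)^(k+m) |g w|]`
  calc B (v, w) ω * (|g v| * |g w|) * |W ((v, w), ω)|
      ≤ (C_B * ((1 + ‖v‖) ^ k * (1 + ‖w‖) ^ k)) * (|g v| * |g w|) *
          (|C_W| * ((1 + ‖v‖) ^ m * (1 + ‖w‖) ^ m)) := by
        refine mul_le_mul (mul_le_mul_of_nonneg_right hB1 (by positivity))
          (hWq.trans (mul_le_mul_of_nonneg_right (le_abs_self _) (by positivity)))
          (abs_nonneg _) (by positivity)
    _ = C_B * |C_W| * (((1 + ‖v‖) ^ (k + m) * |g v|) * ((1 + ‖w‖) ^ (k + m) * |g w|)) := by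
        rw [pow_add, pow_add]; ring
    _ ≤ C_B * |C_W| * ((C_g * ρ v) * (C_g * ρ w)) := by
        refine mul_le_mul_of_nonneg_left ?_ (by positivity)
        exact mul_le_mul (hgw v) (hgw w) (by positivity) (mul_nonneg hCg (hρ0 v))
    _ = C_B * |C_W| * C_g * C_g * (ρ v * ρ w) := by ring

/-- **Integrability of the weak collision integrand for rapidly decaying densities.** For a
micro-reversible measurable kernel of polynomial growth `0 ≤ B ≤ C_B (1 + ‖v - v_*‖)^k`, a
measurable density with `(1 + ‖u‖)^N |g u| ≤ C_g` and a measurable weight of polynomial growth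
`|ψ u| ≤ C_ψ (1 + ‖u‖)^m`, the weak integrand `B (g'g_*' - g g_*) ψ(v)` is integrable on
`E × E × S^{d-1}` whenever `N > dim E + k + m` (CIP 1994 §5.3, proof of Lemma 5.3.1: "if `φ(ξ)` is
of polynomial growth, and if `g(ξ)` decreases rapidly, then [(3.10) holds]"). The gain part is
reduced to a loss-type integrand by the swapped collision map. [cite: CIPDiluteGases1994, §5.3 Lemma 5.3.1 (proof, (3.10))] -/
theorem integrable_collisionWeakIntegrand_of_decay (hBm : Measurable (Function.uncurry B))
    (hB0 : ∀ p ω, 0 ≤ B p ω) {C_B : ℝ} {k : ℕ} (hBle : ∀ p ω, B p ω ≤ C_B * (1 + ‖p.1 - p.2‖) ^ k)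
    (hBc : ∀ p ω, B (collide ω p) (-ω) = B p ω) (hBs : ∀ p ω, B p.swap (-ω) = B p ω)
    {g : E → ℝ} (hgm : Measurable g) {C_g : ℝ} {N : ℕ} (hg : ∀ u, (1 + ‖u‖) ^ N * |g u| ≤ C_g)
    {ψ : E → ℝ} (hψm : Measurable ψ) {C_ψ : ℝ} {m : ℕ} (hψ : ∀ u, |ψ u| ≤ C_ψ * (1 + ‖u‖) ^ m)
    (hN : Module.finrank ℝ E + k + m < N) :
    Integrable (fun q : (E × E) × sphere (0 : E) 1 =>
        B q.1 q.2 * (g (collide q.2 q.1).1 * g (collide q.2 q.1).2 - g q.1.1 * g q.1.2) * ψ q.1.1)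
      (((volume : Measure E).prod volume).prod sphereMeasure) := by
  have hCψ : ∀ u, |ψ u| ≤ |C_ψ| * (1 + ‖u‖) ^ m := fun u =>
    (hψ u).trans (mul_le_mul_of_nonneg_right (le_abs_self _) (by positivity))
  have h1w : ∀ u : E, (1 : ℝ) ≤ (1 + ‖u‖) ^ m := fun u =>
    one_le_pow₀ (by linarith [norm_nonneg u])
  -- the loss-type integrand `L₁ = B g g_* ψ(v)`
  have hL₁ : Integrable (fun q : (E × E) × sphere (0 : E) 1 =>
      B q.1 q.2 * (g q.1.1 * g q.1.2) * ψ q.1.1)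
      (((volume : Measure E).prod volume).prod sphereMeasure) := by
    refine integrable_kernel_mul_mul_weight hBm hB0 hBle hgm hg (hψm.comp measurable_fst.fst)
      (C_W := |C_ψ|) (m := m) (fun q => (hCψ q.1.1).trans ?_) hN
    rw [← mul_assoc]
    exact le_mul_of_one_le_right (by positivity) (h1w _)
  -- the loss-type integrand `L₄ = B g g_* ψ(v_*')`, whose image under `T₁` is the gain part
  have hL₄ : Integrable (fun q : (E × E) × sphere (0 : E) 1 =>
      B q.1 q.2 * (g q.1.1 * g q.1.2) * ψ (collide q.2 q.1).2)
      (((volume : Measure E).prod volume).prod sphereMeasure) := by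
    refine integrable_kernel_mul_mul_weight hBm hB0 hBle hgm hg
      (hψm.comp continuous_collide_uncurry.snd.measurable) (C_W := |C_ψ|) (m := m)
      (fun q => (hCψ _).trans (mul_le_mul_of_nonneg_left ?_ (abs_nonneg _))) hN
    rw [← mul_pow]
    refine pow_le_pow_left₀ (by positivity) ?_ m
    have h := norm_collide_snd_le q.2 q.1
    nlinarith [norm_nonneg q.1.1, norm_nonneg q.1.2]
  have hG₁ : Integrable (fun q : (E × E) × sphere (0 : E) 1 =>
      B q.1 q.2 * (g (collide q.2 q.1).1 * g (collide q.2 q.1).2) * ψ q.1.1)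
      (((volume : Measure E).prod volume).prod sphereMeasure) := by
    have := (integrable_comp_collideSwap_prod_iff (fun q : (E × E) × sphere (0 : E) 1 =>
      B q.1 q.2 * (g q.1.1 * g q.1.2) * ψ (collide q.2 q.1).2)).2 hL₄
    refine this.congr (Eventually.of_forall fun q => ?_)
    simp only [Prod.fst_swap, Prod.snd_swap, kernel_collideSwap hBc hBs, collide_collideSwap]
    ring
  exact (hG₁.sub hL₁).congr (Eventually.of_forall fun q => by simp only [Pi.sub_apply]; ring)

omit [InnerProductSpace ℝ E] [FiniteDimensional ℝ E] [MeasurableSpace E] [BorelSpace E] in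
/-- Elementary inequality behind the decay of the gain term: by conservation of energy,
`(1 + ‖v‖)(1 + ‖v_*‖) ≤ 3 ((1 + ‖v'‖)(1 + ‖v_*'‖))²`. [folklore] -/
theorem one_add_norm_mul_le_three_mul_sq {a b a' b' : ℝ}
    (ha' : 0 ≤ a') (hb' : 0 ≤ b') (h : a' ^ 2 + b' ^ 2 = a ^ 2 + b ^ 2) :
    (1 + a) * (1 + b) ≤ 3 * ((1 + a') * (1 + b')) ^ 2 := by
  nlinarith [sq_nonneg (a - b), sq_nonneg (1 - a), sq_nonneg (1 - b), mul_nonneg ha' hb',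
    mul_nonneg (mul_nonneg ha' hb') (mul_nonneg ha' hb'),
    mul_nonneg ha' (mul_nonneg ha' hb'), mul_nonneg hb' (mul_nonneg ha' hb')]

omit [InnerProductSpace ℝ E] [FiniteDimensional ℝ E] [MeasurableSpace E] [BorelSpace E] in
/-- `x^k / x^M = x^{-(M-k)}` for `x > 0` and `k ≤ M` (natural powers to a real power). [folklore] -/
theorem pow_div_pow_eq_rpow_neg {x : ℝ} (hx : 0 < x) {k M : ℕ} (hkM : k ≤ M) :
    x ^ k / x ^ M = x ^ (-((M - k : ℕ) : ℝ)) := by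
  rw [Real.rpow_neg hx.le, Real.rpow_natCast, div_eq_iff (pow_ne_zero _ hx.ne'),
    ← zpow_natCast, ← zpow_natCast, ← zpow_natCast, ← zpow_neg, ← zpow_add₀ hx.ne']
  congr 1
  push_cast [Nat.cast_sub hkM]
  ring

omit [FiniteDimensional ℝ E] [MeasurableSpace E] [BorelSpace E] in
/-- **Pointwise decay of the collision integrand of a rapidly decaying density**: for a kernel of
polynomial growth `0 ≤ B ≤ C_B (1 + ‖v - v_*‖)^k`, `k ≤ M`, and `(1 + ‖u‖)^{2M} |g u| ≤ C_g`,
`|B (g'g_*' - g g_*)| ≤ 2·3^M |C_B| C_g² (1 + ‖v‖)^{-(M-k)} (1 + ‖v_*‖)^{-(M-k)}` (the gain part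
by conservation of energy). [folklore] -/
theorem abs_collisionIntegrand_le_of_decay (hB0 : ∀ p ω, 0 ≤ B p ω) {C_B : ℝ} {k : ℕ}
    (hBle : ∀ p ω, B p ω ≤ C_B * (1 + ‖p.1 - p.2‖) ^ k) {M : ℕ} (hkM : k ≤ M) {g : E → ℝ}
    {C_g : ℝ} (hg : ∀ u, (1 + ‖u‖) ^ (2 * M) * |g u| ≤ C_g) (p : E × E) (ω : sphere (0 : E) 1) :
    |B p ω * (g (collide ω p).1 * g (collide ω p).2 - g p.1 * g p.2)| ≤
      2 * 3 ^ M * |C_B| * C_g ^ 2 *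
        ((1 + ‖p.1‖) ^ (-((M - k : ℕ) : ℝ)) * (1 + ‖p.2‖) ^ (-((M - k : ℕ) : ℝ))) := by
  have hCg : 0 ≤ C_g := le_trans (by positivity) (hg 0)
  set a : ℝ := ‖p.1‖ with ha
  set b : ℝ := ‖p.2‖ with hb
  set a' : ℝ := ‖(collide ω p).1‖ with ha'
  set b' : ℝ := ‖(collide ω p).2‖ with hb'
  have ha0 : 0 ≤ a := norm_nonneg _
  have hb0 : 0 ≤ b := norm_nonneg _
  have ha'0 : 0 ≤ a' := norm_nonneg _
  have hb'0 : 0 ≤ b' := norm_nonneg _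
  have hen : a' ^ 2 + b' ^ 2 = a ^ 2 + b ^ 2 :=
    Literature.MathematicalPhysics.KineticTheory.norm_sq_collide_fst_add_norm_sq_collide_snd ω p
  set X : ℝ := (1 + a) * (1 + b) with hX
  have hX0 : 0 < X := by positivity
  have hX1 : 1 ≤ X := by rw [hX]; nlinarith
  -- energy conservation: `X^M ≤ 3^M ((1+a')(1+b'))^(2M)`
  have hP : X ^ M ≤ 3 ^ M * ((1 + a') * (1 + b')) ^ (2 * M) := by
    rw [pow_mul, ← mul_pow]
    exact pow_le_pow_left₀ hX0.le (one_add_norm_mul_le_three_mul_sq ha'0 hb'0 hen) M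
  -- the gain product
  have hG : |g (collide ω p).1| * |g (collide ω p).2| * X ^ M ≤ 3 ^ M * (C_g * C_g) := by
    have h1 := hg (collide ω p).1
    have h2 := hg (collide ω p).2
    rw [← ha'] at h1
    rw [← hb'] at h2
    calc |g (collide ω p).1| * |g (collide ω p).2| * X ^ M
        ≤ |g (collide ω p).1| * |g (collide ω p).2| * (3 ^ M * ((1 + a') * (1 + b')) ^ (2 * M)) :=
          mul_le_mul_of_nonneg_left hP (by positivity)
      _ = 3 ^ M * (((1 + a') ^ (2 * M) * |g (collide ω p).1|) *
            ((1 + b') ^ (2 * M) * |g (collide ω p).2|)) := by rw [mul_pow]; ring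
      _ ≤ 3 ^ M * (C_g * C_g) := by
          refine mul_le_mul_of_nonneg_left ?_ (by positivity)
          exact mul_le_mul h1 h2 (by positivity) hCg
  -- the loss product
  have hL : |g p.1| * |g p.2| * X ^ M ≤ C_g * C_g := by
    have h1 := hg p.1
    have h2 := hg p.2
    rw [← ha] at h1
    rw [← hb] at h2
    calc |g p.1| * |g p.2| * X ^ M ≤ |g p.1| * |g p.2| * X ^ (2 * M) :=
          mul_le_mul_of_nonneg_left (pow_le_pow_right₀ hX1 (by omega)) (by positivity)
      _ = ((1 + a) ^ (2 * M) * |g p.1|) * ((1 + b) ^ (2 * M) * |g p.2|) := by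
          rw [hX, mul_pow]; ring
      _ ≤ C_g * C_g := mul_le_mul h1 h2 (by positivity) hCg
  -- the kernel
  have hBX : B p ω ≤ |C_B| * X ^ k := by
    refine (hBle p ω).trans ?_
    refine (mul_le_mul_of_nonneg_right (le_abs_self C_B) (by positivity)).trans ?_
    refine mul_le_mul_of_nonneg_left ?_ (abs_nonneg _)
    rw [hX]
    exact pow_le_pow_left₀ (by positivity) (one_add_norm_sub_le p.1 p.2) k
  -- combine: `|I| X^M ≤ 2 3^M |C_B| C_g² X^k`
  have hI : |B p ω * (g (collide ω p).1 * g (collide ω p).2 - g p.1 * g p.2)| * X ^ M ≤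
      2 * 3 ^ M * |C_B| * C_g ^ 2 * X ^ k := by
    rw [abs_mul, abs_of_nonneg (hB0 p ω)]
    have htri : |g (collide ω p).1 * g (collide ω p).2 - g p.1 * g p.2| ≤
        |g (collide ω p).1| * |g (collide ω p).2| + |g p.1| * |g p.2| := by
      rw [← abs_mul, ← abs_mul]; exact abs_sub _ _
    have h3M : (1 : ℝ) ≤ 3 ^ M := one_le_pow₀ (by norm_num)
    calc B p ω * |g (collide ω p).1 * g (collide ω p).2 - g p.1 * g p.2| * X ^ M
        ≤ (|C_B| * X ^ k) * ((|g (collide ω p).1| * |g (collide ω p).2| + |g p.1| * |g p.2|)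
            * X ^ M) := by
          rw [mul_assoc]
          exact mul_le_mul hBX (mul_le_mul_of_nonneg_right htri (by positivity))
            (by positivity) (by positivity)
      _ = (|C_B| * X ^ k) * (|g (collide ω p).1| * |g (collide ω p).2| * X ^ M +
            |g p.1| * |g p.2| * X ^ M) := by ring
      _ ≤ (|C_B| * X ^ k) * (3 ^ M * (C_g * C_g) + C_g * C_g) := by
          gcongr
      _ ≤ (|C_B| * X ^ k) * (3 ^ M * (C_g * C_g) + 3 ^ M * (C_g * C_g)) := by
          refine mul_le_mul_of_nonneg_left (add_le_add le_rfl ?_) (by positivity)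
          exact le_mul_of_one_le_left (by positivity) h3M
      _ = 2 * 3 ^ M * |C_B| * C_g ^ 2 * X ^ k := by ring
  -- divide by `X^M`
  have hdiv : |B p ω * (g (collide ω p).1 * g (collide ω p).2 - g p.1 * g p.2)| ≤
      2 * 3 ^ M * |C_B| * C_g ^ 2 * (X ^ k / X ^ M) := by
    rw [mul_div_assoc', le_div_iff₀ (pow_pos hX0 M)]
    exact hI
  refine hdiv.trans_eq ?_
  congr 1
  have h1a : (0 : ℝ) < 1 + a := by positivity
  have h1b : (0 : ℝ) < 1 + b := by positivity
  rw [hX, mul_pow, mul_pow, mul_div_mul_comm, pow_div_pow_eq_rpow_neg h1a hkM,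
    pow_div_pow_eq_rpow_neg h1b hkM]

/-- **Pointwise decay of the collision term of a rapidly decaying density**, uniformly in the
density: for a kernel of polynomial growth `0 ≤ B ≤ C_B (1 + ‖v - v_*‖)^k` and `M > dim E + k`
there is `C ≥ 0` such that `|Q_B(g, g)(v)| ≤ C C_g² (1 + ‖v‖)^{-(M-k)}` for every `g` with
`(1 + ‖u‖)^{2M} |g u| ≤ C_g` (CIP 1994 §5.3, the "rapidly decreasing `g`" of the proof of
Lemma 5.3.1). No measurability or integrability of `g` is needed: the Bochner integrals are
estimated by `norm_integral_le_of_norm_le`. [folklore] -/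
theorem exists_abs_collisionOpWith_le_of_decay (hB0 : ∀ p ω, 0 ≤ B p ω) {C_B : ℝ} {k : ℕ}
    (hBle : ∀ p ω, B p ω ≤ C_B * (1 + ‖p.1 - p.2‖) ^ k) {M : ℕ}
    (hM : Module.finrank ℝ E + k < M) :
    ∃ C : ℝ, 0 ≤ C ∧ ∀ (g : E → ℝ) (C_g : ℝ), (∀ u, (1 + ‖u‖) ^ (2 * M) * |g u| ≤ C_g) →
      ∀ v, |collisionOpWith B g g v| ≤ C * C_g ^ 2 * (1 + ‖v‖) ^ (-((M - k : ℕ) : ℝ)) := by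
  haveI := isFiniteMeasure_sphereMeasure (E := E)
  have hkM : k ≤ M := by omega
  set r : ℝ := ((M - k : ℕ) : ℝ) with hr
  have hrE : (Module.finrank ℝ E : ℝ) < r := by
    rw [hr]; exact_mod_cast (by omega : Module.finrank ℝ E < M - k)
  set ρ : E → ℝ := fun u => (1 + ‖u‖) ^ (-r) with hρ
  have hρi : Integrable ρ (volume : Measure E) := integrable_one_add_norm hrE
  set S : ℝ := (sphereMeasure : Measure (sphere (0 : E) 1)).real univ with hS
  refine ⟨2 * 3 ^ M * |C_B| * S * ∫ w, ρ w, ?_, fun g C_g hg v => ?_⟩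
  · have : 0 ≤ ∫ w, ρ w := integral_nonneg fun u => Real.rpow_nonneg (by positivity) _
    positivity
  set Kc : ℝ := 2 * 3 ^ M * |C_B| * C_g ^ 2 with hKc
  set D : E → sphere (0 : E) 1 → ℝ := fun w ω =>
    B (v, w) ω * (g (collide ω (v, w)).1 * g (collide ω (v, w)).2 - g v * g w) with hD
  have hDle : ∀ w ω, |D w ω| ≤ Kc * (ρ v * ρ w) := fun w ω =>
    abs_collisionIntegrand_le_of_decay hB0 hBle hkM hg (v, w) ω
  have hinner : ∀ w, ‖∫ ω, D w ω ∂sphereMeasure‖ ≤ Kc * (ρ v * ρ w) * S := by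
    intro w
    calc ‖∫ ω, D w ω ∂sphereMeasure‖
        ≤ ∫ _ω, Kc * (ρ v * ρ w) ∂(sphereMeasure : Measure (sphere (0 : E) 1)) :=
          norm_integral_le_of_norm_le (integrable_const _)
            (Eventually.of_forall fun ω => by rw [Real.norm_eq_abs]; exact hDle w ω)
      _ = Kc * (ρ v * ρ w) * S := by rw [integral_const, smul_eq_mul, hS, mul_comm]
  have hI : Integrable (fun w => Kc * (ρ v * ρ w) * S) (volume : Measure E) :=
    ((hρi.const_mul (Kc * ρ v)).mul_const S).congr (Eventually.of_forall fun w => by ring)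
  calc |collisionOpWith B g g v| = ‖∫ w, ∫ ω, D w ω ∂sphereMeasure‖ := by
        rw [Real.norm_eq_abs]; rfl
    _ ≤ ∫ w, Kc * (ρ v * ρ w) * S := norm_integral_le_of_norm_le hI (Eventually.of_forall hinner)
    _ = (2 * 3 ^ M * |C_B| * S * ∫ w, ρ w) * C_g ^ 2 * ρ v := by
        rw [show (fun w => Kc * (ρ v * ρ w) * S) = fun w => (Kc * ρ v * S) * ρ w from
          funext fun w => by ring, integral_const_mul, hKc]
        ring

end Decay

end

end Literature.Analysis.FluidPDE
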